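import Summits.SmoothPoincare4.SmoothPoincare4.Theorems.SymplecticOrigamiGromovRecognitionRelEndHelperPosFrameAlongSurfaceConst

/-!
# The orientation character of a tangent–normal frame along a surface is constant
# (continuous normal fields)
(registered helper `helper_posFrameAlongSurfaceConstC` of the stub `stub_normalWitnessTransfer`,
line `cross-cap-laurent`, crux `GromovRecognitionRelEnd`, item stmt-SmoothPoincare4-11009)

Setting (`Literature.Topology.FourManifolds.CodimTwoData 2 X S ℝᵐ`): a Whitney embedding
`e : X → ℝᵐ` of the `4`-manifold `X` (smooth, with injective differential) and an embedded
surface `b : S → X`; a smooth map `c : O → S` on an open preconnected `O ⊆ ℂ`; two fields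
`N₁ z, N₂ z ∈ T_{b (c z)} X` whose images `de (N_j z) = ν_j z` are merely *continuous*
`ℝᵐ`-valued fields on `O`; and the moving `4`-frame `(d(b ∘ c)_z 1, d(b ∘ c)_z i, N₁ z, N₂ z)`
of `T_{b (c z)} X`, assumed linearly independent on `O`.  Claim
(`helper_posFrameAlongSurfaceConstC`): its orientation character
(`SmoothOrientation.IsPosFrame` for a smooth orientation `o` of `X`, the frame being reindexed by
`finCongr finrank_euclideanSpace_fin`) is the same at all points of `O`
(M. W. Hirsch, *Differential Topology* (1976), Ch. 4 §4: the orientation of a continuously moving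
frame is constant along a connected parameter set).

This is the continuous-normal-field variant of the landed helper
`helper_posFrameAlongSurfaceConst` (same file stem without the trailing `C`), whose proof only
ever used continuity of the chart readings of the frame.  Proof: the tree's constancy principle
`Literature.Topology.FourManifolds.SmoothOrientation.isPosFrame_iff_of_isPreconnected`.
Non-degeneracy: `det_ne_zero_of_linearIndependent` (linear independence is invariant under
reindexing).  Continuity of the frame read in the chart at `p : X`, on
`O ∩ (b ∘ c)⁻¹(chart domain of p)`: for the two tangent vectors by
`HelperPosFrameAlongSurfaceConst.continuousOn_tangentCoordChange_mfderiv` (the reading is the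
honest derivative of the smooth map `φ_p ∘ b ∘ c` between vector spaces), and for the two normal
vectors by `HelperPosFrameAlongSurfaceConst.continuousOn_tangentCoordChange_normal`, which
already only assumes `ν_j` continuous (the reading of `N_j z = leftInv (de) (ν_j z)` is
`leftInv (D(e ∘ φ_p⁻¹)(φ_p (b (c z)))) (ν_j z)`, and `leftInv` is smooth at the injective chart
derivatives).

Reference: M. W. Hirsch, *Differential Topology*, GTM 33, Springer (1976), Ch. 4 §4
[HirschDT1976].  No new definitions.
-/

noncomputable section

open Set Function Module
open scoped Manifold ContDiff Topology

-- the prescribed namespace `Summit.<P>.<Sub>.…` duplicates `SmoothPoincare4` (P = Sub)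
set_option linter.dupNamespace false

namespace Summit.SmoothPoincare4.SmoothPoincare4.Theorems.GromovRecognitionRelEnd.CrossCapLaurent

open Literature.Topology.FourManifolds

open HelperPosFrameAlongSurfaceConst in
/-- **Registered helper `helper_posFrameAlongSurfaceConstC`: the orientation character of a
tangent–normal frame along a surface is constant (continuous normal fields).**  In the Whitney
picture `D : CodimTwoData 2 X S ℝᵐ` of an embedded surface `b : S → X` in a `4`-manifold `X`
with smooth orientation `o`, along a smooth map `c : O → S` (`O ⊆ ℂ` open and preconnected),
the `4`-frame `(d(b ∘ c)_z 1, d(b ∘ c)_z i, N₁ z, N₂ z)` of `T_{b (c z)} X` — where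
`de (N_j z) = ν_j z` are continuous on `O` — is, if linearly independent on `O`, positively
oriented either at every point of `O` or at none (Hirsch, *Differential Topology* (1976),
Ch. 4 §4: apply `SmoothOrientation.isPosFrame_iff_of_isPreconnected`; the chart readings of the
frame are continuous by `continuousOn_tangentCoordChange_mfderiv` and
`continuousOn_tangentCoordChange_normal`). [folklore] -/
theorem helper_posFrameAlongSurfaceConstC : ∀ (m : ℕ) (X : Type) [TopologicalSpace X] [ChartedSpace (EuclideanSpace ℝ (Fin 4)) X] [IsManifold (𝓡 4) ∞ X] (S : Type) [TopologicalSpace S] [ChartedSpace (EuclideanSpace ℝ (Fin 2)) S] [IsManifold (𝓡 2) ∞ S] (D : Literature.Topology.FourManifolds.CodimTwoData 2 X S (EuclideanSpace ℝ (Fin m))) (o : Literature.Topology.FourManifolds.SmoothOrientation (𝓡 4) X) (c : ℂ → S) (ν₁ ν₂ : ℂ → EuclideanSpace ℝ (Fin m)) (N₁ N₂ : ℂ → EuclideanSpace ℝ (Fin 4)) (O : Set ℂ), IsOpen O → IsPreconnected O → ContMDiffOn 𝓘(ℝ, ℂ) (𝓡 2) ∞ c O → ContinuousOn ν₁ O →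 ContinuousOn ν₂ O → (∀ z ∈ O, mfderiv (𝓡 4) 𝓘(ℝ, EuclideanSpace ℝ (Fin m)) D.e (D.b (c z)) (N₁ z) = ν₁ z ∧ mfderiv (𝓡 4) 𝓘(ℝ, EuclideanSpace ℝ (Fin m)) D.e (D.b (c z)) (N₂ z) = ν₂ z) → (∀ z ∈ O, LinearIndependent ℝ ![mfderiv 𝓘(ℝ, ℂ) (𝓡 4) (fun z => D.b (c z)) z (1 : ℂ), mfderiv 𝓘(ℝ, ℂ) (𝓡 4) (fun z => D.b (c z)) z Complex.I, N₁ z, N₂ z]) → ∀ z ∈ O, ∀ z' ∈ O, (o.IsPosFrame (D.b (c z)) (![mfderiv 𝓘(ℝ, ℂ) (𝓡 4) (fun z => D.b (c z)) z (1 : ℂ), mfderiv 𝓘(ℝ, ℂ) (𝓡 4) (fun z => D.b (c z)) z Complex.I, N₁ z, N₂ z] ∘ ⇑(finCongr finrank_euclideanSpace_fin)) ↔ o.IsPosFrame (D.b (c z')) (![mfderiv 𝓘(ℝ, ℂ) (𝓡 4) (fun z => D.b (c z)) z' (1 : ℂ), mfderiv 𝓘(ℝ, ℂ) (𝓡 4)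 (fun z => D.b (c z)) z' Complex.I, N₁ z', N₂ z'] ∘ ⇑(finCongr finrank_euclideanSpace_fin))) := by
  intro m X _ _ _ S _ _ _ D o c ν₁ ν₂ N₁ N₂ O hO hOc hc hν₁ hν₂ hN hli z hz z' hz'
  -- the surface map `γ = b ∘ c : O → X` is smooth
  have hγ : ContMDiffOn 𝓘(ℝ, ℂ) (𝓡 4) ∞ (fun w => D.b (c w)) O := D.hb.comp_contMDiffOn hc
  refine o.isPosFrame_iff_of_isPreconnected hOc (γ := fun w => D.b (c w))
    (B := fun w => ![mfderiv 𝓘(ℝ, ℂ) (𝓡 4) (fun z => D.b (c z)) w (1 : ℂ),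
      mfderiv 𝓘(ℝ, ℂ) (𝓡 4) (fun z => D.b (c z)) w Complex.I, N₁ w, N₂ w] ∘
        ⇑(finCongr finrank_euclideanSpace_fin))
    hγ.continuousOn (fun p => ?_) (fun w hw => ?_) hz hz'
  · -- the readings of the frame in the chart at `p` are continuous
    refine continuousOn_pi.2 fun i => ?_
    have key : ∀ j : Fin 4, ContinuousOn
        (fun w => tangentCoordChange (𝓡 4) (D.b (c w)) p (D.b (c w))
          (![mfderiv 𝓘(ℝ, ℂ) (𝓡 4) (fun z => D.b (c z)) w (1 : ℂ),
            mfderiv 𝓘(ℝ, ℂ) (𝓡 4) (fun z => D.b (c z)) w Complex.I, N₁ w, N₂ w] j))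
        (O ∩ (fun w => D.b (c w)) ⁻¹' (chartAt (EuclideanSpace ℝ (Fin 4)) p).source) := by
      intro j
      fin_cases j
      · exact continuousOn_tangentCoordChange_mfderiv hO hγ p (1 : ℂ)
      · exact continuousOn_tangentCoordChange_mfderiv hO hγ p Complex.I
      · exact continuousOn_tangentCoordChange_normal D hγ.continuousOn hν₁
          (fun w hw => (hN w hw).1) p
      · exact continuousOn_tangentCoordChange_normal D hγ.continuousOn hν₂
          (fun w hw => (hN w hw).2) p
    exact key _
  · -- the frame is non-degenerate
    exact det_ne_zero_of_linearIndependent _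
      ((hli w hw).comp _ (finCongr finrank_euclideanSpace_fin).injective)

end Summit.SmoothPoincare4.SmoothPoincare4.Theorems.GromovRecognitionRelEnd.CrossCapLaurent
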